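import Mathlib.NumberTheory.ArithmeticFunction.VonMangoldt
import Mathlib.NumberTheory.LegendreSymbol.JacobiSymbol
import Literature.Analysis.ValidatedNumerics.MultiPrecisionInterval
import HarnessLib

/-!
# Lagarias (1999), the question of pp. 220–221 — coefficients and the kernel certificate

J. C. Lagarias, *On a positivity property of the Riemann ξ-function*, Acta Arith. **89** (1999)
217–234 [LagariasXiPositivity1999], asks on pp. 220–221 whether for every number field `K` the
infimum `h_K(σ) = inf_t Re ξ_K'/ξ_K(σ+it)` is attained on the real axis for all `σ > 1`
(`Literature.NumberTheory.LFunctions.Lagarias1999.Question`). The answer is negative already for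
`K = ℚ(√−163)`, `σ = 2`, `t = 7/4` (`Lagarias1999.Refutation`).

This file holds the two real sequences entering the cosine-free lower bound for
`ξ_K'/ξ_K(2) − Re ξ_K'/ξ_K(2+it)` (`Lagarias1999.Bounds`):
* `lambdaK q n = Λ(n)(1 + (n/q))` — the Dirichlet coefficients of `−ζ_K'/ζ_K` for a quadratic field
  with `ζ_K = ζ·L(·,(·/q))` ((2.14) of the paper), and
* `psiDropTerm t k = 1/((k+2)((k+2)²+t²))` — the terms of `(Re ψ(2+it) − Re ψ(2))/t²`,
and the integer program `cert163` (scale `SC = 2^64`, interval logarithms `MI.logNat` of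
`Literature.Analysis.ValidatedNumerics`) checking, for `q = 163` and `t = 7/4`,
`Σ_{n ≤ 1000} Λ_K(n)/n² ≤ 0.2009`, `log 1000 ≤ 6.9078` and
`(49/16)(Σ_{k<100} psiDropTerm (7/4) k + 1/(2·101·102)) ≤ 0.41131`, together with its kernel
evaluation `cert163_true` (standard axioms; `decide +kernel`, no `native_decide`). The program never
decides primality: `Λ(n) ≤ log d` for any divisor `d ≥ 2` of `n`, `Λ(qm) = 0` for coprime
`q, m > 1`, and the twelve primes below `41` (all inert in `ℚ(√−163)`) contribute `0`; every branch
re-checks the arithmetic facts its soundness proof (`Lagarias1999.Refutation`) uses.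
-/

open scoped ArithmeticFunction.vonMangoldt NumberTheorySymbols
open Literature.Analysis.ValidatedNumerics Literature.Analysis.ValidatedNumerics.NumericsMP

namespace Literature.NumberTheory.LFunctions.Lagarias1999

/-! ## The two coefficient sequences -/

/-- (2.14): `Λ_K(n) = Λ(n) (1 + (n/q))`, the Dirichlet coefficients of `−ζ_K'/ζ_K` for a quadratic
field with `ζ_K = ζ · L(·, (·/q))`; they are real and non-negative.
[cite: LagariasXiPositivity1999, (2.14)] -/
noncomputable def lambdaK (q n : ℕ) : ℝ := Λ n * (1 + (J((n : ℤ) | q) : ℝ))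

/-- The terms `1/((k+2)((k+2)² + t²))` of `(Re ψ(2+it) − Re ψ(2))/t²` (Mittag-Leffler expansion
(2.16) of `ψ`). [cite: LagariasXiPositivity1999, (2.16)] -/
noncomputable def psiDropTerm (t : ℝ) (k : ℕ) : ℝ := 1 / (((k : ℝ) + 2) * (((k : ℝ) + 2) ^ 2 + t ^ 2))

/-! ## The kernel program -/

/-- Binary working scale of the interval logarithms. [folklore] -/
def SC : ℕ := 2 ^ 64

/-- Number of series terms in `MI.logNat`. [folklore] -/
def KLOG : ℕ := 72

/-- `n` is one of the twelve primes below `41` (all inert in `ℚ(√−163)`: `(p/163) = −1`). [folklore] -/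
def isInert (n : ℕ) : Bool :=
  n == 2 || n == 3 || n == 5 || n == 7 || n == 11 || n == 13 || n == 17 || n == 19 || n == 23 ||
    n == 29 || n == 31 || n == 37

/-- First `c ∈ [c₀, c₀ + fuel)` dividing `n`, else `n` itself. [folklore] -/
def firstDiv : ℕ → ℕ → ℕ → ℕ
  | 0, n, _ => n
  | fuel + 1, n, c => if n % c = 0 then c else firstDiv fuel n (c + 1)

/-- Strip every factor `d` from `m` (fuel-bounded). [folklore] -/
def stripFactor : ℕ → ℕ → ℕ → ℕ
  | 0, m, _ => m
  | fuel + 1, m, d => if 1 < d ∧ 0 < m ∧ m % d = 0 then stripFactor fuel (m / d) d else m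

/-- Core of `termHi` for `n ≥ 2` not an inert prime, given a candidate divisor `d`, cofactor
`m` and `q = n/m`: `0` when `n = q·m` with `q, m > 1` coprime (then `Λ(n) = 0`), else
`⌈2·(log d)·SC/n²⌉` when `d ≥ 2` divides `n` (`Λ(n) ≤ log d`). Every branch re-checks what it
uses. [folklore] -/
def termHiCore (n d m q : ℕ) : Option ℤ :=
  if q * m = n ∧ 1 < q ∧ 1 < m ∧ Nat.gcd q m = 1 then some 0
  else if n % d = 0 ∧ 2 ≤ d then
    match MI.logNat SC KLOG d with
    | some lg => some (Numerics.cdiv (2 * lg.hi) ((n * n : ℕ) : ℤ))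
    | none => none
  else none

/-- A scaled upper bound for `Λ_K(n)/n²`, `K = ℚ(√−163)`: `0` for `n < 2` and for the inert
primes below `41`, else `termHiCore` with the first divisor `d ∈ [2, 42)` of `n` (or `n`). [folklore] -/
def termHi (n : ℕ) : Option ℤ :=
  if n < 2 then some 0
  else if isInert n then some 0
  else termHiCore n (firstDiv 40 n 2) (stripFactor 20 n (firstDiv 40 n 2))
    (n / stripFactor 20 n (firstDiv 40 n 2))

/-- Scaled upper bound for `Σ_{n<N} Λ_K(n)/n²`. [folklore] -/
def sumHi : ℕ → Option ℤ
  | 0 => some 0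
  | n + 1 =>
    match sumHi n, termHi n with
    | some a, some b => some (a + b)
    | _, _ => none

/-- Scaled upper bound for `1/((k+2)((k+2)² + (7/4)²)) = 16/((k+2)(16(k+2)²+49))`. [folklore] -/
def qTermHi (k : ℕ) : ℤ := (MI.ofFrac SC 16 ((k + 2) * (16 * (k + 2) ^ 2 + 49))).hi

/-- Scaled upper bound for `Σ_{k<M} 1/((k+2)((k+2)² + 49/16))`. [folklore] -/
def qSumHi : ℕ → ℤ
  | 0 => 0
  | k + 1 => qSumHi k + qTermHi k

/-- **The certificate**: `Σ_{n≤1000} Λ_K(n)/n² ≤ 0.2009`, `log 1000 ≤ 6.9078`,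
`(49/16)(Σ_{k<100} 1/((k+2)((k+2)²+49/16)) + 1/(2·101·102)) ≤ 0.41131`.
[cite: LagariasXiPositivity1999, pp. 220–221] -/
def cert163 : Bool :=
  match sumHi 1001, MI.logNat SC KLOG 1000 with
  | some T, some lg =>
      decide (T * 10000 ≤ 2009 * (SC : ℤ)) && decide (lg.hi * 10000 ≤ 69078 * (SC : ℤ)) &&
        decide (49 * (qSumHi 100 * 20604 + (SC : ℤ)) * 100000 ≤ 41131 * 16 * 20604 * (SC : ℤ))
  | _, _ => false

set_option maxHeartbeats 4000000 in
/-- The certificate evaluates to `true` in the kernel (a few seconds of GMP-accelerated `Nat`/`Int`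
reduction; standard axioms, no `native_decide`). [cite: LagariasXiPositivity1999, pp. 220–221] -/
theorem cert163_true : cert163 = true := by decide +kernel

end Literature.NumberTheory.LFunctions.Lagarias1999
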